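import Literature.Geometry.Symplectic.DefectZeroOfEliashberg
import Literature.Geometry.Symplectic.LegendrianRealisationProofs
import HarnessLib

/-!
# The defect-zero criterion of Akbulut–Matveyev from E2 and ISO alone (ST discharged)

Topic `Literature/Geometry/Symplectic`; proofs file (theorems only, no named facts) below
`DefectZeroOfEliashberg.lean`, for the proof obligation of
`Literature.Geometry.Symplectic.akbulut_matveyev` (Akbulut–Matveyev 1998, Thm. 3).

`DefectZeroOfEliashberg.lean` derives the defect-zero criterion of Akbulut–Matveyev (1998), §3
— *"So if the defect is zero, the PC structure extends over 2-handles"* — from three named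
facts: Eliashberg's theorem **E2** (`Gompf1998_thm13_twoHandles`), the stabilisation **ST**
(`Gompf1998_addLeftTwists`: a `C⁰`-small isotopy in `∂W` adds any number of left twists to a
framed Legendrian knot; Gompf 1998, §1, p. 622) and the isotopy invariance of 2-handle
attachment **ISO** (`HandleAttachingMap.isMultiAttachment_of_linkIsotopyInBoundary`).  ST has
since been PROVED in the tree (`Gompf1998_addLeftTwists_holds`,
`LegendrianRealisationProofs.lean`: Darboux box along a Legendrian arc, explicit model spiral,
twisting computation), so the criterion now rests on E2 and ISO only; this file records that
form, binder for binder, feeding `Gompf1998_addLeftTwists_holds` to the derivations of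
`DefectZeroOfEliashberg.lean`:

* `AkbulutMatveyev1998_defectZero_of_E2_ISO` — the criterion for a finite family of 2-handles;
* `AkbulutMatveyev1998_defectZero_of_E2_ISO_single` — one 2-handle (AM §3, first paragraph:
  *"If `tb(K) ≥ f + 1` then by `C⁰`-small smooth isotopy of `K` we can decrease
  Thurston-Bennequin invariant of `K` and make it equal to `f + 1`.  Therefore, by a theorem of
  Eliashberg, manifold `Z ∪ h` possesses PC structure"*);
* `AkbulutMatveyev1998_defectZero_iff_thm13_twoHandles_of_ISO` — under ISO alone, the
  criterion is equivalent to E2.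

Status of the remaining inputs (2026-08-15): E2 is a named fact (Eliashberg's holomorphic
2-handle; `SteinTwoHandles.lean`, `SteinTwoHandlesProofs.lean` reduce it to its construction
form); ISO is proved conditionally on three classical statements of differential topology
(ambient isotopy extension, uniqueness of tubular neighbourhoods, uniqueness of collars;
`TwoHandleIsotopyReduction.lean`).

## References

* S. Akbulut, R. Matveyev, *A convex decomposition theorem for 4-manifolds*, IMRN 1998, no. 7,
  371–381 (arXiv:math/0010166), Thm. 2 and §3 (p. 3). [AkbulutMatveyev1998]
* R. E. Gompf, *Handlebody construction of Stein surfaces*, Ann. of Math. 148 (1998), 619–693,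
  §1 (p. 622) and Thm. 1.3. [Gompf1998]
-/

noncomputable section

open scoped Manifold ContDiff Topology

namespace Literature.Geometry.Symplectic

open Literature.Topology.FourManifolds

/-- **The defect-zero criterion (Akbulut–Matveyev 1998, §3) from E2 and ISO**, the
stabilisation ST being the tree's theorem `Gompf1998_addLeftTwists_holds`: if `P` is a compact
Stein `(W, S)` with finitely many 2-handles attached along Legendrian attaching circles whose
handle framings all have defect `0`, then `P` admits a Stein structure.
[cite: AkbulutMatveyev1998, §3] -/
theorem AkbulutMatveyev1998_defectZero_of_E2_ISO (hE : Gompf1998_thm13_twoHandles)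
    (hISO : HandleAttachingMap.isMultiAttachment_of_linkIsotopyInBoundary)
    (W P : Type) [TopologicalSpace W] [T2Space W] [ChartedSpace (EuclideanHalfSpace 4) W]
    [IsManifold (𝓡∂ 4) ∞ W] [CompactSpace W] [TopologicalSpace P]
    [ChartedSpace (EuclideanHalfSpace 4) P] [IsManifold (𝓡∂ 4) ∞ P] [CompactSpace P]
    (S : SteinStructure W) (ι : Type) [Finite ι] (h : ι → HandleAttachingMap 3 2 W)
    (hP : HandleAttachingMap.IsMultiAttachment h (𝓡∂ 4) P)
    (hLeg : ∀ i, IsLegendrianKnot S.J (h i).attachingCircle)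
    (hd : ∀ i, S.defect (h i).attachingCircle (h i).attachingFraming = 0) : IsSteinDomain P :=
  AkbulutMatveyev1998_defectZero_of_E2_ST_ISO hE Gompf1998_addLeftTwists_holds hISO W P S ι h hP
    hLeg hd

/-- **D ⟺ E2 under ISO** (ST discharged): the defect-zero criterion of Akbulut–Matveyev
(1998), §3, spelled out on the left, is equivalent to Eliashberg's theorem
`Gompf1998_thm13_twoHandles`. [cite: AkbulutMatveyev1998, §3] -/
theorem AkbulutMatveyev1998_defectZero_iff_thm13_twoHandles_of_ISO
    (hISO : HandleAttachingMap.isMultiAttachment_of_linkIsotopyInBoundary) :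
    (∀ (W P : Type) [TopologicalSpace W] [T2Space W] [ChartedSpace (EuclideanHalfSpace 4) W]
      [IsManifold (𝓡∂ 4) ∞ W] [CompactSpace W] [TopologicalSpace P]
      [ChartedSpace (EuclideanHalfSpace 4) P] [IsManifold (𝓡∂ 4) ∞ P] [CompactSpace P]
      (S : SteinStructure W) (ι : Type) [Finite ι] (h : ι → HandleAttachingMap 3 2 W),
      HandleAttachingMap.IsMultiAttachment h (𝓡∂ 4) P →
      (∀ i, IsLegendrianKnot S.J (h i).attachingCircle) →
      (∀ i, S.defect (h i).attachingCircle (h i).attachingFraming = 0) →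
      IsSteinDomain P) ↔ Gompf1998_thm13_twoHandles :=
  AkbulutMatveyev1998_defectZero_iff_thm13_twoHandles Gompf1998_addLeftTwists_holds hISO

section Single

variable {W P : Type} [TopologicalSpace W] [T2Space W] [ChartedSpace (EuclideanHalfSpace 4) W]
  [IsManifold (𝓡∂ 4) ∞ W] [CompactSpace W] [TopologicalSpace P]
  [ChartedSpace (EuclideanHalfSpace 4) P] [IsManifold (𝓡∂ 4) ∞ P] [CompactSpace P]

/-- **One 2-handle of defect `0`, from E2 and ISO** (AM §3, first paragraph: *"If
`tb(K) ≥ f + 1` then by `C⁰`-small smooth isotopy of `K` we can decrease Thurston-Bennequin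
invariant of `K` and make it equal to `f + 1`.  Therefore, by a theorem of Eliashberg, manifold
`Z ∪ h` possesses PC structure"*; the `C⁰`-small isotopy is `Gompf1998_addLeftTwists_holds`).
[cite: AkbulutMatveyev1998, §3] -/
theorem AkbulutMatveyev1998_defectZero_of_E2_ISO_single (hE : Gompf1998_thm13_twoHandles)
    (hISO : HandleAttachingMap.isMultiAttachment_of_linkIsotopyInBoundary)
    (S : SteinStructure W) (h₁ : HandleAttachingMap 3 2 W)
    (hP : HandleAttachingMap.IsMultiAttachment (fun _ : Unit => h₁) (𝓡∂ 4) P)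
    (hLeg : IsLegendrianKnot S.J h₁.attachingCircle)
    (hd : S.defect h₁.attachingCircle h₁.attachingFraming = 0) : IsSteinDomain P :=
  AkbulutMatveyev1998_defectZero_of_E2_ST_ISO_single hE Gompf1998_addLeftTwists_holds hISO S h₁
    hP hLeg hd

end Single

end Literature.Geometry.Symplectic

end
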